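import Summits.ResolutionOfSingularities.ResolutionOfSingularities.Theorems.EquisingularLiftEquisingularLiftNatSubmaxLineShape
import HarnessLib

/-!
# The honest residual of the route decl `EquisingularLiftNat` (stmt-ResolutionOfSingularities-20038) RE-CUT BY NAME at `n = 3`: surfaces with a
# line of submaximal multiplicity (in any linear coordinates) are discharged in every characteristic

[OURS · leafhand-res-equisingularlift-7 g0, 2026-08-31; cell `pub/decomp-res`; items stmt-…-20038 / -20148] AI-produced, weaker than expert review;
NOT a statement of any manuscript; nothing here proves resolution of singularities.  DEF-FREE; no `sorry`; standard axioms; ZERO named hypotheses;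
pure reduction over ✓ `QuadricELNat.equisingularLiftNat_of_forall_elnatO_primeForms_three_le` (p820141) and ✓ `SubmaxLine.elNatAt_of_linSubst_mem_pow`
(p822585).

* ★ `equisingularLiftNat_of_forall_elnatO_off_submaxLine` — `Theses.EquisingularLift.EquisingularLiftNat` holds BY NAME as soon as
  `ELNatConclusionO` is known for the non-regular integral `H ⊆ ℙⁿ_k̄` cut out by prime forms `F` of degree `e ≥ 3`, `n ≥ 3`, which — WHEN `n = 3` — have
  NO line of multiplicity `e − 1` in any linear coordinate system (`σ_{τ'} F ∉ (x₂, x₃)^{e−1}` for all invertible linear substitutions).  For `n ≥ 4`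
  the hypothesis is unchanged (that part contains the summit).

Honest reading: closes no registered stub; the `n = 3` residual now starts at the NORMAL cubic surfaces with isolated singularities that are not cones.
-/

set_option linter.dupNamespace false -- mandated namespace `Summit.<Summit>.<Problem>` of this single-conjunct summit

noncomputable section

open CategoryTheory CategoryTheory.Limits AlgebraicGeometry TopologicalSpace
open MvPolynomial
open Literature.AlgebraicGeometry.Resolution
open Literature.AlgebraicGeometry.Motives Literature.AlgebraicGeometry.Motives.SmoothHypersurface
open Literature.AlgebraicGeometry.Motives.ProjectiveSpace

namespace Summit.ResolutionOfSingularities.ResolutionOfSingularities.Cruxes.EquisingularLiftNat.Sections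

namespace SubmaxLine

/-- ★ **`Theses.EquisingularLift.EquisingularLiftNat` (stmt-…-20038) from `ELNatConclusionO` OFF THE SUBMAXIMAL-LINE SURFACES**: the hypothesis of
✓ `QuadricELNat.equisingularLiftNat_of_forall_elnatO_primeForms_three_le` weakened, at `n = 3`, by the clause «for all mutually inverse linear
substitutions `τ, τ'` and all `d` with `σ_{τ'} F` homogeneous of degree `d + 2`: `σ_{τ'} F ∉ (x_{n−1}, x_n)^{d+1}`» — those `H` being settled by
✓ `elNatAt_of_linSubst_mem_pow` in every characteristic. [OURS · lh7 · DEF-FREE · pure reduction] [cite: Hartshorne1977, I Ex. 5.12] -/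
theorem equisingularLiftNat_of_forall_elnatO_off_submaxLine
    (h : ∀ p : ℕ, p.Prime → ∀ (k : Type) [Field k] [CharP k p] [IsAlgClosed k] (n : ℕ) (H : Scheme.{0})
      (ι : H ⟶ (Literature.AlgebraicGeometry.Motives.projectiveSpace n k).left), IsClosedImmersion ι → IsIntegral H →
      (∀ y : (Literature.AlgebraicGeometry.Motives.projectiveSpace n k).left,
        ∃ U : (Literature.AlgebraicGeometry.Motives.projectiveSpace n k).left.affineOpens,
          y ∈ (U : (Literature.AlgebraicGeometry.Motives.projectiveSpace n k).left.Opens) ∧ (ι.ker.ideal U).IsPrincipal) →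
      (hn : 3 ≤ n) → ¬ Scheme.IsRegular H → ∀ (e : ℕ) (F : MvPolynomial (Fin (n + 1)) k), 3 ≤ e → F.IsHomogeneous e → Prime F →
      (letI := MvPolynomial.gradedAlgebra (σ := Fin (n + 1)) (R := k)
       Set.range ι = {x : Proj (homogeneousSubmodule (Fin (n + 1)) k) | F ∈ x.asHomogeneousIdeal}) →
      (n = 3 → ∀ (τ τ' : Fin (n + 1) → MvPolynomial (Fin (n + 1)) k) (d : ℕ),
        (∀ i, (τ i).IsHomogeneous 1) → (∀ i, (τ' i).IsHomogeneous 1) → (∀ i, aeval τ (τ' i) = X i) → (∀ i, aeval τ' (τ i) = X i) →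
        (aeval τ' F).IsHomogeneous (d + 2) →
        aeval τ' F ∉ (Ideal.span {(X ⟨n - 1, by omega⟩ : MvPolynomial (Fin (n + 1)) k), X ⟨n, by omega⟩}) ^ (d + 1)) →
      ELNatConclusionO k n H ι) :
    Summit.ResolutionOfSingularities.ResolutionOfSingularities.Theses.EquisingularLift.EquisingularLiftNat := by
  refine QuadricELNat.equisingularLiftNat_of_forall_elnatO_primeForms_three_le ?_
  intro p hp k _ _ _ n H ι hι hH hloc hn hreg e F he hF hprime hrange
  by_cases h3 : n = 3
  · subst h3
    by_cases hex : ∃ (τ τ' : Fin (3 + 1) → MvPolynomial (Fin (3 + 1)) k) (d : ℕ),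
        (∀ i, (τ i).IsHomogeneous 1) ∧ (∀ i, (τ' i).IsHomogeneous 1) ∧ (∀ i, aeval τ (τ' i) = X i) ∧ (∀ i, aeval τ' (τ i) = X i) ∧
        (aeval τ' F).IsHomogeneous (d + 2) ∧
        aeval τ' F ∈ (Ideal.span {(X 2 : MvPolynomial (Fin 4) k), X 3}) ^ (d + 1)
    · obtain ⟨τ, τ', d, hτ, hτ', hinv, hinv', hFd, hmem⟩ := hex
      haveI := hι
      exact RouteCurrency.elnatO_of_elNatAt p hp k 3 H ι hι hH
        (elNatAt_of_linSubst_mem_pow p hp τ τ' hτ hτ' hinv hinv' ι F hprime hFd hmem hrange)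
    · push Not at hex
      exact h p hp k 3 H ι hι hH hloc hn hreg e F he hF hprime hrange
        (fun _ τ τ' d hτ hτ' hinv hinv' hFd hmem => hex τ τ' d hτ hτ' hinv hinv' hFd hmem)
  · exact h p hp k n H ι hι hH hloc hn hreg e F he hF hprime hrange (fun h3' => absurd h3' h3)

end SubmaxLine

end Summit.ResolutionOfSingularities.ResolutionOfSingularities.Cruxes.EquisingularLiftNat.Sections

end
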